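import Literature.Analysis.FluidPDE.FluidComputer.EnstrophyCurvature
import Literature.Analysis.FluidPDE.FluidComputer.MaskRefinement
import Literature.Analysis.FluidPDE.FluidComputer.GalerkinExistence
import Literature.Analysis.FluidPDE.FluidComputer.TaylorGreenCurvature
import HarnessLib

/-!
# Mode birth: an empty wavevector of the truncated system is seeded at second order in time, `E(k,t) = ½|P_k N_S(k)|² (t-t₀)² + o((t-t₀)²)`; for a refinement, the birth amplitude IS the spill

PLACEMENT: cell-own elementary lemmas of `pub-fluidc` (topic `FluidComputer` under the host summit; the
hub's 2026-08-19 rule keeps `Literature/` for cited published statements). Vocabulary from Literature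
`FluidComputer` (`IsGalerkinSolution`, `rateFun`, `energyRate`, `leray`, `advection`, `GalerkinODE.spill`).
HONEST FRAMING (cell `pub-fluidc`, verbatim): *low prior, high value-of-information experiment on Tao's
machine paradigm; NOT a claim that NS blows up.* The object is the finite Galerkin system (exact arithmetic);
nothing is said about the Navier–Stokes PDE.

THE STATEMENT. Let `U` be an unforced Galerkin solution on a mode set `S` (any viscosity `ν`, any pressure
multiplier `c`), supported in `S`, and let `k ∈ S` be EMPTY at time `t₀`: `û(k,t₀) = 0`. Then

* `rateFun_eq_leray_of_coeff_eq_zero` — the velocity of the coefficient is the Leray-projected truncated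
  advection term, `dû(k)/dt (t₀) = P_k N_S[û(t₀)](k)` (the viscous term vanishes with `û(k)`; the pressure
  multiplier is determined by incompressibility of the rate, `c(k)|k|² = k·N_S(k)`);
* `hasDerivAt_modalEnergy_of_coeff_eq_zero` — `dE(k)/dt (t₀) = 0`;
* `hasDerivAt_energyRate_of_coeff_eq_zero` — the net transfer INTO `k` starts growing at rate
  `dT(k)/dt (t₀) = |P_k N_S(k)|²` (of the three product-rule terms of `EnstrophyCurvature.hasDerivAt_energyRate`
  only the one differentiating the receiving slot survives; `Σ_p (k·û(k-p)) û(p) = i N_S(k)`, `Im(i z) = Re z`,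
  and `Re⟨P_k N, N⟩ = |P_k N|²` by `k · P_k N = 0`);
* **`hasDerivAt_deriv_modalEnergy_of_coeff_eq_zero` (MODE BIRTH)** — `d²E(k)/dt² (t₀) = |P_k N_S[û(t₀)](k)|²
  = Σ_j |P_k N_S(k)_j|²`: an empty mode is born with energy `½|P_k N_S(k)|²(t-t₀)²` to second order, whatever
  `ν` (dissipation enters at third order);
* **`hasDerivAt_deriv_modalEnergy_eq_spill` (REFINEMENT)** — if at `t₀` the state is supported in a coarser
  mask `T ⊆ S` and `k ∈ S ∖ T`, the birth rate of `k` in the FINE system is `Σ_j |spill_T(k)_j|²` with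
  `MaskRefinement`'s `spill T 0 (U t₀) k = P_k N_T[û(t₀)](k)`: the quantity the coarse run DISCARDS at `k` is
  exactly the amplitude with which the fine run CREATES mode `k` (typed complement of `MaskRefinement` /
  `Summits/…/SpillBound`: the defect of 'coarse read as fine' and the seeding of the added modes are one object).

For the cell: (i) why `KidaPelzCurvature`'s hypothesis `E3 ⊆ S` carries the number — the excited box is where
`P_k N_S[kp] ≠ 0`, and those modes are born at exactly these rates (the curvature `Σ_k (|k|²-11)|P_k N|²` is the
`|k|²`-moment of the birth rates minus `11×` their sum); (ii) for the S8 telescoping question, the first thing a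
512³→1024³ continuation does is to populate the added shells at rate `|spill|²`, the same `spill` whose size
bounds the continuation error. [folklore] statements; no named facts (D-0026); 0 sorry.
-/

noncomputable section

namespace Summit.NavierStokesRegularity.FluidComputer

open Complex ComplexConjugate Finset
open scoped BigOperators
open Literature.Analysis.FluidPDE.FluidComputer Literature.Analysis.FluidPDE.FluidComputer.ShellTransfer
  Literature.Analysis.FluidPDE.FluidComputer.ShellTransfer.GalerkinODE

namespace ModeBirth

/-- `Σ_{p∈S} (k·Â(k-p)) Â(p)_j = i · N_S[A](k)_j` (the truncated advection term is `-i ×` this sum). -/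
theorem sum_kdot_mul_coeff (A : FourierVelocity) (S : Finset (Fin 3 → ℤ)) (k : Fin 3 → ℤ) (j : Fin 3) :
    ∑ p ∈ S, kdot k (A.coeff (k - p)) * A.coeff p j = I * advection A S k j := by
  unfold advection
  rw [← mul_assoc, mul_neg, Complex.I_mul_I, neg_neg, one_mul]

/-- `Re⟨P_k a, a⟩ = Σ_j |(P_k a)_j|²`: against its own Leray projection the gradient part of `a` drops out
(`k · P_k a = 0`). -/
theorem re_cdot_conj_leray (k : Fin 3 → ℤ) (a : Fin 3 → ℂ) :
    (cdot (fun j => conj (leray k a j)) a).re = ∑ j, Complex.normSq (leray k a j) := by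
  unfold cdot
  have hk : ∑ j, ((k j : ℤ) : ℂ) * leray k a j = 0 := kdot_leray k a
  have e : ∀ j, a j = leray k a j + kdot k a / (knormSq k : ℂ) * ((k j : ℤ) : ℂ) := fun j => by
    rw [leray_apply]; ring
  have h1 : ∑ j, conj (leray k a j) * a j =
      ∑ j, conj (leray k a j) * leray k a j +
        kdot k a / (knormSq k : ℂ) * conj (∑ j, ((k j : ℤ) : ℂ) * leray k a j) := by
    rw [map_sum, Finset.mul_sum, ← Finset.sum_add_distrib]
    refine Finset.sum_congr rfl fun j _ => ?_
    rw [map_mul, map_intCast]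
    conv_lhs => rw [e j]
    ring
  rw [h1, hk, map_zero, mul_zero, add_zero, Complex.re_sum]
  refine Finset.sum_congr rfl fun j _ => ?_
  rw [← Complex.normSq_eq_conj_mul_self, Complex.ofReal_re]

section Birth

variable {U : ℝ → FourierVelocity} {S : Finset (Fin 3 → ℤ)} {ν : ℝ} {c : ℝ → (Fin 3 → ℤ) → ℂ}
  (hU : IsGalerkinSolution U S ν c fun _ _ _ => 0) (hsupp : IsSupportedOn U S) {t₀ : ℝ} {k : Fin 3 → ℤ}
  (hk : k ∈ S) (hz : (U t₀).coeff k = 0)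
include hU hsupp hk hz

/-- **The velocity of an empty coefficient is the Leray-projected advection term**:
`dû_j(k)/dt (t₀) = (P_k N_S[û(t₀)](k))_j` when `û(k,t₀) = 0` (`k ∈ S`; any `ν`, any pressure multiplier —
the multiplier is forced to `(k·N_S(k))/|k|²` by incompressibility of the rate field). -/
theorem rateFun_eq_leray_of_coeff_eq_zero (j : Fin 3) :
    rateFun U S ν c (fun _ _ _ => 0) t₀ k j = leray k (advection (U t₀) S k) j := by
  have hcoef : ∀ i, rateFun U S ν c (fun _ _ _ => 0) t₀ k i =
      advection (U t₀) S k i - c t₀ k * ((k i : ℤ) : ℂ) := by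
    intro i
    unfold rateFun galerkinRHS
    rw [if_pos hk, show (U t₀).coeff k i = 0 from congrFun hz i]
    ring
  have hdiv := rateFun_divFree hU hsupp t₀ k
  simp_rw [hcoef] at hdiv
  have hkN : kdot k (advection (U t₀) S k) = c t₀ k * (knormSq k : ℂ) := by
    unfold kdot
    rw [← sum_intCast_mul_self, Finset.mul_sum]
    have e : ∑ i, ((k i : ℤ) : ℂ) * (advection (U t₀) S k i - c t₀ k * ((k i : ℤ) : ℂ)) =
        ∑ i, ((k i : ℤ) : ℂ) * advection (U t₀) S k i - ∑ i, c t₀ k * (((k i : ℤ) : ℂ) * ((k i : ℤ) : ℂ)) := by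
      rw [← Finset.sum_sub_distrib]
      refine Finset.sum_congr rfl fun i _ => ?_
      ring
    rw [e] at hdiv
    exact sub_eq_zero.mp hdiv
  rw [hcoef, leray_apply, hkN]
  by_cases hk0 : knormSq k = 0
  · have h0 : k = 0 := (knormSq_eq_zero_iff k).mp hk0
    subst h0
    simp
  · have : (knormSq k : ℂ) ≠ 0 := by exact_mod_cast hk0
    rw [mul_div_assoc, div_self this, mul_one]

omit hsupp in
/-- `dE(k)/dt (t₀) = 0` at an empty mode. -/
theorem hasDerivAt_modalEnergy_of_coeff_eq_zero : HasDerivAt (fun s => modalEnergy (U s) k) 0 t₀ := by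
  have h := hasDerivAt_modalEnergy_galerkin hU t₀ hk
  have hE : modalEnergy (U t₀) k = 0 := by
    unfold modalEnergy; simp [hz]
  have hT : energyRate (U t₀) S k = 0 := energyRate_eq_zero_of_coeff _ _ hz
  convert h using 1
  rw [hE, hT]
  unfold cdot
  simp

omit hsupp hk hz in
/-- The first derivative of a modal energy along an unforced Galerkin solution, as a function:
`E'(k) = -2ν|k|² E(k) + T(k)`. -/
theorem deriv_modalEnergy_eq {k : Fin 3 → ℤ} (hk : k ∈ S) :
    deriv (fun s => modalEnergy (U s) k) =
      fun s => -(2 * ν * knormSq k) * modalEnergy (U s) k + energyRate (U s) S k := by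
  funext s
  rw [(hasDerivAt_modalEnergy_galerkin hU s hk).deriv]
  unfold cdot
  simp

/-- **The transfer into an empty mode starts growing at rate `|P_k N_S(k)|²`**:
`dT(k)/dt (t₀) = Σ_j |(P_k N_S[û(t₀)](k))_j|²`. -/
theorem hasDerivAt_energyRate_of_coeff_eq_zero :
    HasDerivAt (fun s => energyRate (U s) S k)
      (∑ j, Complex.normSq (leray k (advection (U t₀) S k) j)) t₀ := by
  have h := hasDerivAt_energyRate hU hsupp t₀ k
  have hW : ∀ j, (rateField hU hsupp t₀).coeff k j = leray k (advection (U t₀) S k) j := fun j => by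
    rw [rateField_coeff]; exact rateFun_eq_leray_of_coeff_eq_zero hU hsupp hk hz j
  have hz' : ∀ i, conj ((U t₀).coeff k i) = 0 := fun i => by rw [congrFun hz i]; simp
  have h1 : ∀ p, triTransfer (rateField hU hsupp t₀) (U t₀) (U t₀) k p = 0 := fun p => by
    unfold triTransfer cdot; simp [hz']
  have h2 : ∀ p, triTransfer (U t₀) (rateField hU hsupp t₀) (U t₀) k p = 0 := fun p => by
    unfold triTransfer cdot; simp [hz']
  have h3 : ∑ p ∈ S, kdot k ((U t₀).coeff (k - p)) *
      cdot (fun i => conj ((rateField hU hsupp t₀).coeff k i)) ((U t₀).coeff p) =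
      I * cdot (fun i => conj (leray k (advection (U t₀) S k) i)) (advection (U t₀) S k) := by
    simp_rw [hW]
    unfold cdot
    calc ∑ p ∈ S, kdot k ((U t₀).coeff (k - p)) *
          ∑ i, conj (leray k (advection (U t₀) S k) i) * (U t₀).coeff p i
        = ∑ p ∈ S, ∑ i, conj (leray k (advection (U t₀) S k) i) *
            (kdot k ((U t₀).coeff (k - p)) * (U t₀).coeff p i) := by
          refine Finset.sum_congr rfl fun p _ => ?_
          rw [Finset.mul_sum]
          refine Finset.sum_congr rfl fun i _ => ?_
          ring
      _ = ∑ i, ∑ p ∈ S, conj (leray k (advection (U t₀) S k) i) *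
            (kdot k ((U t₀).coeff (k - p)) * (U t₀).coeff p i) := Finset.sum_comm
      _ = ∑ i, conj (leray k (advection (U t₀) S k) i) * (I * advection (U t₀) S k i) := by
          refine Finset.sum_congr rfl fun i _ => ?_
          rw [← Finset.mul_sum, sum_kdot_mul_coeff]
      _ = I * ∑ i, conj (leray k (advection (U t₀) S k) i) * advection (U t₀) S k i := by
          rw [Finset.mul_sum]
          refine Finset.sum_congr rfl fun i _ => ?_
          ring
  convert h using 1
  simp_rw [h1, h2, zero_add]
  unfold triTransfer
  rw [← Complex.im_sum, h3, Complex.I_mul_im, re_cdot_conj_leray]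

/-- **MODE BIRTH.** Along an unforced Galerkin solution (any `ν`, any pressure multiplier), a mode
`k ∈ S` that is empty at `t₀` has `d²E(k)/dt² (t₀) = Σ_j |(P_k N_S[û(t₀)](k))_j|² = |P_k N_S(k)|²`:
it is born with energy `½|P_k N_S(k)|² (t - t₀)²` to second order. -/
theorem hasDerivAt_deriv_modalEnergy_of_coeff_eq_zero :
    HasDerivAt (deriv fun s => modalEnergy (U s) k)
      (∑ j, Complex.normSq (leray k (advection (U t₀) S k) j)) t₀ := by
  rw [deriv_modalEnergy_eq hU hk]
  have h := ((hasDerivAt_modalEnergy_of_coeff_eq_zero hU hk hz).const_mul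
    (-(2 * ν * knormSq k))).add (hasDerivAt_energyRate_of_coeff_eq_zero hU hsupp hk hz)
  refine h.congr_deriv ?_
  rw [mul_zero, zero_add]

end Birth

/-- **FOR A REFINEMENT THE BIRTH AMPLITUDE IS THE SPILL.** Let `U` be an unforced Galerkin solution on
the FINE mask `S`, supported in `S`, whose state at `t₀` is supported in a coarser mask `T ⊆ S` (e.g. the
fine continuation of a coarse run from its state at `t₀`). Then every added mode `k ∈ S ∖ T` is born with
`d²E(k)/dt² (t₀) = Σ_j |spill_T(k)_j|²`, `spill T 0 (U t₀) k = P_k N_T[û(t₀)](k)` (`MaskRefinement`): the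
term the coarse system discards at `k` is the amplitude with which the fine system creates mode `k`. -/
theorem hasDerivAt_deriv_modalEnergy_eq_spill {U : ℝ → FourierVelocity} {S T : Finset (Fin 3 → ℤ)} {ν : ℝ}
    {c : ℝ → (Fin 3 → ℤ) → ℂ} (hU : IsGalerkinSolution U S ν c fun _ _ _ => 0) (hsupp : IsSupportedOn U S)
    {t₀ : ℝ} (hTS : T ⊆ S) (hT : ∀ p ∉ T, (U t₀).coeff p = 0) {k : Fin 3 → ℤ} (hk : k ∈ S) (hkT : k ∉ T) :
    HasDerivAt (deriv fun s => modalEnergy (U s) k)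
      (∑ j, Complex.normSq (spill T 0 (U t₀) k j)) t₀ := by
  have h := hasDerivAt_deriv_modalEnergy_of_coeff_eq_zero hU hsupp hk (hT k hkT)
  rw [advection_eq_of_subset (U t₀) hTS hT k] at h
  have e : ∀ j, spill T 0 (U t₀) k j = leray k (advection (U t₀) T k) j := fun j => by
    rw [spill_apply]
    congr 1
    funext i
    simp
  simp_rw [e]
  exact h

/-! ## (v2) The Taylor–Green instance: the eight excited modes are born at rate `1/512` each -/

section TaylorGreen

open Literature.Analysis.FluidPDE.FluidComputer.ShellTransfer.TaylorGreenHat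

/-- On the eight excited modes `(±2,0,±2), (0,±2,±2)` of the Taylor–Green datum,
`Σ_j |(P_k N_S[tg](k))_j|² = 1/512` (from `TaylorGreenCurvature.curvatureTerm_eq`: `(|k|²-3)·(…) = 5/512`
with `|k|² = 8`). -/
theorem tg_birthRate_of_mem_rateModes {S : Finset (Fin 3 → ℤ)} (hS : modes ⊆ S) {k : Fin 3 → ℤ}
    (hk : k ∈ rateModes) : ∑ j, Complex.normSq (leray k (advection tg S k) j) = 1 / 512 := by
  have h := curvatureTerm_eq hS k
  rw [if_pos hk] at h
  have hK : knormSq k = 8 := by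
    obtain h8 := mem_rateModes.mp hk
    unfold knormSq
    rw [Fin.sum_univ_three]
    rcases h8 with ⟨h0, h1, h2⟩ | ⟨h0, h1, h2⟩
    · rcases mem_pmTwo.mp h0 with e0 | e0 <;> rcases mem_pmTwo.mp h2 with e2 | e2 <;>
        simp [e0, h1, e2] <;> norm_num
    · rcases mem_pmTwo.mp h1 with e1 | e1 <;> rcases mem_pmTwo.mp h2 with e2 | e2 <;>
        simp [h0, e1, e2] <;> norm_num
  rw [hK] at h
  linarith

/-- Off the excited modes (and off the datum's own eight modes) nothing is born at second order:
`Σ_j |(P_k N_S[tg](k))_j|² = 0` for `k ∉ rateModes`, `|k|² ≠ 3`. -/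
theorem tg_birthRate_eq_zero {S : Finset (Fin 3 → ℤ)} (hS : modes ⊆ S) {k : Fin 3 → ℤ}
    (hk : k ∉ rateModes) (h3 : knormSq k ≠ 3) : ∑ j, Complex.normSq (leray k (advection tg S k) j) = 0 := by
  have h := curvatureTerm_eq hS k
  rw [if_neg hk] at h
  rcases mul_eq_zero.mp h with h0 | h0
  · exact absurd (sub_eq_zero.mp h0) h3
  · exact h0

/-- **TAYLOR–GREEN MODE BIRTH.** Along any unforced Galerkin solution from the Taylor–Green datum on a
mode set containing its eight modes (any `ν`, any pressure multiplier), each excited mode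
`k ∈ {(±2,0,±2), (0,±2,±2)}` that lies in `S` is born with `d²E(k)/dt² (0) = 1/512`, i.e.
`E(k,t) = t²/1024 + o(t²)` — the shell `|k|² = 8` starts as `8 × t²/1024 = t²/128`. -/
theorem hasDerivAt_deriv_modalEnergy_tg {U : ℝ → FourierVelocity} {S : Finset (Fin 3 → ℤ)} {ν : ℝ}
    {c : ℝ → (Fin 3 → ℤ) → ℂ} (hU : IsGalerkinSolution U S ν c fun _ _ _ => 0) (hsupp : IsSupportedOn U S)
    (h0 : U 0 = tg) (hS : modes ⊆ S) {k : Fin 3 → ℤ} (hkS : k ∈ S) (hk : k ∈ rateModes) :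
    HasDerivAt (deriv fun s => modalEnergy (U s) k) (1 / 512) 0 := by
  have hz : (U 0).coeff k = 0 := by
    rw [h0]
    refine coeff_of_not_mem fun hkm => ?_
    have h3 := knormSq_of_mem_modes hkm
    have h8 : knormSq k = 8 := by
      have h := curvatureTerm_eq hS k
      rw [if_pos hk, h3] at h
      norm_num at h
    linarith
  have h := hasDerivAt_deriv_modalEnergy_of_coeff_eq_zero hU hsupp hkS hz
  rw [h0, tg_birthRate_of_mem_rateModes hS hk] at h
  exact h

end TaylorGreen

end ModeBirth

end Summit.NavierStokesRegularity.FluidComputer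

end
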